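import Mathlib
import HarnessLib
import Literature.MathematicalPhysics.StatisticalMechanics.RenormalisationMap

/-!
# Proposition 6.6 of [ABKM19] with the integrability hypothesis only for DISJOINT polymer pairs

`RenormalisationMap.rgStep_identity` (Proposition 6.6, `∫(e^{−H_k}∘K_k)(Λ,φ+ξ)μ_{k+1}(dξ) =
(e^{−H_{k+1}}∘K_{k+1})(Λ,φ)`) asks for the `μ_{k+1}`-integrability of `ξ ↦ e^{−H(Z,φ+ξ)}K(Y,φ+ξ)`
for ALL pairs of `k`-polymers `Z, Y`.  Its proof (`RenormalisationStepAlgebra.integrable_midK`) only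
ever meets the products `I^{W}(φ+ξ)K(X∖Y∖Z', φ+ξ)` with `W ⊆ Z' ⊆ X∖Y` ((6.32)), i.e. DISJOINT pairs —
and disjointness is exactly what the weight inequality (w5) of Theorem 7.1 needs to bound such
products in the norms (`w_k^Y ∏_{B∈𝓑(W)}W_k^B ≤ w_k^{W∪Y}` for `W ∩ Y = ∅`).  This file records the
sharper form:

* `integrable_midK_of_disjoint` — `Φ(X, φ, ·)` is integrable when the products over disjoint pairs are;
* `integral_pcirc_eq_pcirc_nextK_of_disjoint`, `integral_pcirc_cexp_eq_of_disjoint` — Proposition 6.6,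
  generic and exponential forms;
* **`rgStep_identity_of_disjoint`** — (6.13) for `T_k` under
  `∀ Z Y ∈ 𝓟_k, Z ∩ Y = ∅ → ξ ↦ e^{−H(Z,φ+ξ)}K(Y,φ+ξ) ∈ L¹(μ_{k+1})`.

Everything is proved; no named fact (the proofs are those of `RenormalisationStepAlgebra`, verbatim
up to the bookkeeping of disjointness).

## References
* S. Adams, S. Buchholz, R. Kotecký, S. Müller, arXiv:1910.13564, Ch. 6.3 (6.31)–(6.34),
  Proposition 6.6 [AdamsBuchholzKoteckyMuller2019].
-/

noncomputable section

namespace Literature.MathematicalPhysics.StatisticalMechanics.GradientRG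

open scoped BigOperators Classical
open Finset MeasureTheory
open Literature.MathematicalPhysics.StatisticalMechanics.TorusPolymer

variable {d M : ℕ} [NeZero M] {𝕜 : Type*} [RCLike 𝕜]

/-- **`Φ(X, φ, ·)` is integrable** when every `ξ ↦ I^{Z}(φ+ξ) K(Y, φ+ξ)` with `Z, Y` DISJOINT
`k`-polymers is. [cite: AdamsBuchholzKoteckyMuller2019, Ch. 6.3 (6.32)] -/
theorem integrable_midK_of_disjoint {s : ℕ} {I It K : Finset (Fin d → ZMod M) → ((Fin d → ZMod M) → ℝ) → 𝕜}
    {μ : Measure ((Fin d → ZMod M) → ℝ)} {φ : (Fin d → ZMod M) → ℝ}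
    (hint : ∀ Z Y, IsPolymer s Z → IsPolymer s Y → Disjoint Z Y →
      Integrable (fun ξ => bprod s (fun B => I B (φ + ξ)) Z * K Y (φ + ξ)) μ)
    {X : Finset (Fin d → ZMod M)} (hX : IsPolymer s X) :
    Integrable (fun ξ => midK s I It K X φ ξ) μ := by
  simp_rw [midK_eq_sum I It K X φ]
  refine integrable_finsetSum _ fun Y hY => integrable_finsetSum _ fun Z hZ =>
    integrable_finsetSum _ fun W hW => Integrable.const_mul ?_ _
  have hYp := (mem_polys.1 hY).2
  have hZp := (mem_polys.1 hZ).2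
  have hWZ : W ⊆ Z := (mem_polys.1 hW).1
  have hdisj : Disjoint W ((X \ Y) \ Z) :=
    Finset.disjoint_of_subset_left hWZ Finset.disjoint_sdiff
  exact hint W ((X \ Y) \ Z) (mem_polys.1 hW).2 ((hX.sdiff hYp).sdiff hZp) hdisj

/-- **Proposition 6.6 / (6.13), generic form, disjoint-pair integrability.**
[cite: AdamsBuchholzKoteckyMuller2019, Proposition 6.6] -/
theorem integral_pcirc_eq_pcirc_nextK_of_disjoint {s L : ℕ} (hs : Odd s) (hL : Odd L)
    {π : Finset (Fin d → ZMod M) → Finset (Fin d → ZMod M)}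
    (hπ : ∀ X, IsPolymer s X → IsPolymer (L * s) (π X))
    (μ : Measure ((Fin d → ZMod M) → ℝ))
    {I It K : Finset (Fin d → ZMod M) → ((Fin d → ZMod M) → ℝ) → 𝕜} {φ : (Fin d → ZMod M) → ℝ}
    (hIt : ∀ B, It B φ ≠ 0)
    (hint : ∀ Z Y, IsPolymer s Z → IsPolymer s Y → Disjoint Z Y →
      Integrable (fun ξ => bprod s (fun B => I B (φ + ξ)) Z * K Y (φ + ξ)) μ) :
    ∫ ξ, pcirc s (bprod s fun B => I B (φ + ξ)) (fun Y => K Y (φ + ξ)) univ ∂μ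
      = pcirc (L * s) (fun U => nextK s π μ I It K U φ) (bprod s fun B => It B φ) univ := by
  have hΛ : IsPolymer s (univ : Finset (Fin d → ZMod M)) := isPolymer_univ s
  have h1 : ∫ ξ, pcirc s (bprod s fun B => I B (φ + ξ)) (fun Y => K Y (φ + ξ)) univ ∂μ
      = ∑ X ∈ polys s univ, bprod s (fun B => It B φ) (univ \ X) * ∫ ξ, midK s I It K X φ ξ ∂μ := by
    simp_rw [pcirc_bprod_eq_pcirc_midK I It K hΛ φ, pcirc_apply_symm _ _ hΛ]
    rw [integral_finsetSum]
    · exact Finset.sum_congr rfl fun X _ => integral_const_mul _ _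
    · intro X hX
      exact (integrable_midK_of_disjoint hint (mem_polys.1 hX).2).const_mul _
  rw [h1, sum_reblock hs hL hπ hIt, pcirc]
  exact Finset.sum_congr rfl fun U _ => by rw [nextK, mul_comm]

/-- **Proposition 6.6 as printed, disjoint-pair integrability** (`𝕜 = ℂ`, `I = e^{−H}`, `Ĩ = e^{−H̃}`).
[cite: AdamsBuchholzKoteckyMuller2019, Proposition 6.6] -/
theorem integral_pcirc_cexp_eq_of_disjoint {s L : ℕ} (hs : Odd s) (hL : Odd L)
    {π : Finset (Fin d → ZMod M) → Finset (Fin d → ZMod M)}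
    (hπ : ∀ X, IsPolymer s X → IsPolymer (L * s) (π X))
    (μ : Measure ((Fin d → ZMod M) → ℝ)) (H Ht : RelevantHamiltonian ℂ d)
    {K : Finset (Fin d → ZMod M) → ((Fin d → ZMod M) → ℝ) → ℂ} {φ : (Fin d → ZMod M) → ℝ}
    (hint : ∀ Z Y, IsPolymer s Z → IsPolymer s Y → Disjoint Z Y →
      Integrable (fun ξ => Complex.exp (-(eval H Z (φ + ξ))) * K Y (φ + ξ)) μ) :
    ∫ ξ, pcirc s (fun Z => Complex.exp (-(eval H Z (φ + ξ)))) (fun Y => K Y (φ + ξ)) univ ∂μ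
      = ∑ U ∈ polys (L * s) univ,
          nextK s π μ (fun B ψ => Complex.exp (-(eval H B ψ))) (fun B ψ => Complex.exp (-(eval Ht B ψ)))
            K U φ * Complex.exp (-(eval Ht (univ \ U) φ)) := by
  have hΛ : IsPolymer s (univ : Finset (Fin d → ZMod M)) := isPolymer_univ s
  have h := integral_pcirc_eq_pcirc_nextK_of_disjoint hs hL hπ μ
    (I := fun B ψ => Complex.exp (-(eval H B ψ))) (It := fun B ψ => Complex.exp (-(eval Ht B ψ)))
    (K := K) (φ := φ) (fun B => Complex.exp_ne_zero _) ?_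
  · have hl : ∀ ξ, pcirc s (fun Z => Complex.exp (-(eval H Z (φ + ξ)))) (fun Y => K Y (φ + ξ)) univ
        = pcirc s (bprod s fun B => Complex.exp (-(eval H B (φ + ξ)))) (fun Y => K Y (φ + ξ)) univ :=
      fun ξ => pcirc_congr_left _ fun Z hZ _ => (bprod_cexp_neg_eval H hZ (φ + ξ)).symm
    simp_rw [hl]
    rw [h, pcirc]
    refine Finset.sum_congr rfl fun U hU => ?_
    rw [bprod_cexp_neg_eval Ht (hΛ.sdiff ((mem_polys.1 hU).2.of_mul hs hL)) φ]
  · intro Z Y hZ hY hZY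
    simp_rw [bprod_cexp_neg_eval H hZ]
    exact hint Z Y hZ hY hZY

/-- **Proposition 6.6 / (6.13) for `T_k`, disjoint-pair integrability**: for odd `s, L` and a step
measure making `ξ ↦ e^{−H(Z, φ+ξ)} K(Y, φ+ξ)` integrable for all DISJOINT `k`-polymers `Z, Y`:
`∫ (e^{−H_k} ∘_k K_k)(Λ, φ+ξ) μ_{k+1}(dξ) = (K_{k+1} ∘_{k+1} e^{−H_{k+1}})(Λ, φ)`.
[cite: AdamsBuchholzKoteckyMuller2019, Proposition 6.6] -/
theorem rgStep_identity_of_disjoint (D : StepData d M) (hs : Odd D.s) (hL : Odd D.L) (H : RelevantHamiltonian ℂ d)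
    {K : Finset (Fin d → ZMod M) → ((Fin d → ZMod M) → ℝ) → ℂ} {φ : (Fin d → ZMod M) → ℝ}
    (hint : ∀ Z Y, IsPolymer D.s Z → IsPolymer D.s Y → Disjoint Z Y →
      Integrable (fun ξ => Complex.exp (-(eval H Z (φ + ξ))) * K Y (φ + ξ)) (stepMeasure D.𝒞)) :
    ∫ ξ, pcirc D.s (fun Z => expNegH H Z (φ + ξ)) (fun Y => K Y (φ + ξ)) univ ∂(stepMeasure D.𝒞)
      = pcirc (D.L * D.s) (fun U => nextKStep D H K U φ) (fun V => expNegH (nextH D H K) V φ) univ := by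
  unfold expNegH nextKStep
  rw [integral_pcirc_cexp_eq_of_disjoint hs hL (fun X _ => isPolymer_reblock D.s (D.L * D.s) X)
    (stepMeasure D.𝒞) H (nextH D H K) hint]
  rfl

end Literature.MathematicalPhysics.StatisticalMechanics.GradientRG

end
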